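import Summits.ValiantsHypothesis.ValiantsHypothesis.Theorems.GrenetZeonDualUnipotentThreeHalvesHeavyTopNecklace

/-!
# King–Procesi NECKLACE helper, part 2 (§5 RATIO COMPLETENESS) — Theorems-side PORT of val-idea-28 g3's crux workfile
# `Cruxes/DualUnipotentThreeHalves/KingProcesi.lean` (crux `GrenetZeon.DualUnipotentThreeHalves` = stmt-ValiantsHypothesis-24318, residue R2 `HeavyTopLaw`)

PORT NOTE.  Text of §5 of `Cruxes/DualUnipotentThreeHalves/KingProcesi.lean` (tree sha16 184e374b2da444d6; 0 `sorry`; crit-7 V#10/V#14 PASS)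
VERBATIM BY NAME under `…Theorems.GrenetZeon.Necklace`, importing part 1 (`…HeavyTopNecklace.lean`: §1 word algebra — `word_append` is
used by `word_flatten` below —, §2 height-free ratio obstruction, §3 the refuter's necklace kill, §4 level-adapted bases).  ALL CREDIT:
val-idea-28 g0–g3 (card `king-procesi-necklace`).  Port hand val-port-3 g3 (desk val-lit g14 RULING #350 (A); α LEAD val-port-2 g3),
`--supports stmt-ValiantsHypothesis-24318` helper.  Only non-verbatim change besides namespace/header/split: one-line docstrings ADDED on
`rich_append`, `not_rich_nil`, `count_take_le_succ` (gate lint `lint.docstring`); statements and proofs untouched.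

CONTENT (author's summary of §5).  RATIO COMPLETENESS (King's criterion made elementary, Jacobson form): if every `(r:c)`-rich necklace
is TRACELESS then a word profile of ratio `(r:c)` EXISTS — `∃ Θ, ∀ w, word ≠ 0 → c·#T₁(w) ≤ Θ + r·#T₀(w)` (`exists_profile_of_necklace_null`,
`Θ = c·(L−1)`, `L` the nilpotency exponent of the radical of the positive-degree algebra `Algebra.adjoin ℂ (richWords …)`; hence
`WordTame n k` for every `k ≥ (Θ + r(n−1))/(c+r)`, `exists_wordTame_of_necklace_null`).  Mechanism: rich ⊗ rich = rich, so the rich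
words are trace-orthogonal to the algebra they generate (tree `RadicalCoarsening.mem_jacobson_of_traceOrth`), hence radical, hence
products of `L` of them vanish (`exists_jacobson_pow_eq_bot`, `list_prod_mem_pow`); a word of necklace degree `> c(L−1)` cuts greedily
into `L` rich pieces (`exists_rich_pieces`).  Reading: necklace traces decide the RATIO clause of a flag certificate and are blind to
its HEIGHT clause (calibration (4,7): `NSeven` necklace-null yet not flag-cheap, ✗ p648631).

Nothing here proves R2, the crux, or VP ≠ VNP; 24318 is OPEN.
-/

-- single-conjunct layout: Sub = Summit, duplicated namespace component intended
set_option linter.dupNamespace false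

namespace Summit.ValiantsHypothesis.ValiantsHypothesis.Theorems.GrenetZeon.Necklace

open Summit.ValiantsHypothesis.ValiantsHypothesis.Theorems.GrenetZeon.RadicalSplit
open Summit.ValiantsHypothesis.ValiantsHypothesis.Cruxes.TwoDimCoefficients.DimTwoCases (AffMat IsAffine)

variable {m : ℕ}

/-! ## §5 Ratio completeness: necklace-null at ratio `(r:c)` ⇒ a word profile of that ratio
(King's criterion made elementary — the Jacobson-radical form, over the tree's `RadicalCoarsening` machinery) -/

section Completeness

open Summit.ValiantsHypothesis.ValiantsHypothesis.Theorems.GrenetZeon.RadicalCoarsening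
  (mem_jacobson_of_traceOrth exists_jacobson_pow_eq_bot list_prod_mem_pow)

/-- A word is RATIO-RICH for `(r:c)` («positive necklace degree») if `r·#T₀(w) < c·#T₁(w)`. -/
def Rich (r c : ℕ) (w : List Bool) : Prop := r * w.count false < c * w.count true

/-- Rich ⊗ rich = rich: concatenation of two `(r:c)`-rich words is rich. [folklore; docstring added in the port] -/
theorem rich_append {r c : ℕ} {w w' : List Bool} (hw : Rich r c w) (hw' : Rich r c w') : Rich r c (w ++ w') := by
  unfold Rich at *
  rw [List.count_append, List.count_append, mul_add, mul_add]
  omega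

/-- The empty word is not rich. [folklore; docstring added in the port] -/
theorem not_rich_nil (r c : ℕ) : ¬ Rich r c ([] : List Bool) := by
  simp [Rich]

/-- Words of a concatenation of pieces. [folklore] -/
theorem word_flatten (T₀ T₁ : Matrix (Fin m) (Fin m) ℂ) (ps : List (List Bool)) :
    word T₀ T₁ ps.flatten = (ps.map (word T₀ T₁)).prod := by
  induction ps with
  | nil => simp [word]
  | cons p ps ih => rw [List.flatten_cons, word_append, ih, List.map_cons, List.prod_cons]

/-- Letter counts grow by at most one per letter taken. [folklore] -/
theorem count_take_succ_le (w : List Bool) (j : ℕ) (b : Bool) :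
    (w.take (j + 1)).count b ≤ (w.take j).count b + 1 := by
  rw [List.take_add_one, List.count_append]
  have : (w[j]?.toList).count b ≤ 1 := by
    cases w[j]? with
    | none => simp
    | some a => cases a <;> cases b <;> simp
  omega

/-- Letter counts of prefixes are monotone. [folklore; docstring added in the port] -/
theorem count_take_le_succ (w : List Bool) (j : ℕ) (b : Bool) :
    (w.take j).count b ≤ (w.take (j + 1)).count b := by
  rw [List.take_add_one, List.count_append]
  omega

/-- **Shortest rich prefix.**  A rich word splits as `p ++ u` with `p` rich of necklace degree `≤ c`
(`c·#T₁(p) ≤ r·#T₀(p) + c`). [this file] -/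
theorem exists_rich_prefix {r c : ℕ} (w : List Bool) (hw : Rich r c w) :
    ∃ p u : List Bool, w = p ++ u ∧ Rich r c p ∧ c * p.count true ≤ r * p.count false + c := by
  classical
  have hex : ∃ j, Rich r c (w.take j) := ⟨w.length, by rwa [List.take_length]⟩
  have hpos : Nat.find hex ≠ 0 := by
    intro h0
    have h := Nat.find_spec hex
    rw [h0, List.take_zero] at h
    exact not_rich_nil r c h
  obtain ⟨j, hj⟩ := Nat.exists_eq_succ_of_ne_zero hpos
  have hrich : Rich r c (w.take (j + 1)) := by
    have h := Nat.find_spec hex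
    rwa [hj] at h
  have hmin : ¬ Rich r c (w.take j) := Nat.find_min hex (by rw [hj]; exact Nat.lt_succ_self j)
  refine ⟨w.take (j + 1), w.drop (j + 1), (List.take_append_drop _ _).symm, hrich, ?_⟩
  unfold Rich at hmin
  have h1 := count_take_succ_le w j true
  have h2 := count_take_le_succ w j false
  have h3 : c * (w.take (j + 1)).count true ≤ c * ((w.take j).count true + 1) := Nat.mul_le_mul_left c h1
  have h4 : r * (w.take j).count false ≤ r * (w.take (j + 1)).count false := Nat.mul_le_mul_left r h2
  rw [mul_add, mul_one] at h3
  omega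

/-- **Cutting lemma.**  A word of necklace degree `> c·(K−1)` — precisely `r·#T₀ + c·K < c·#T₁ + c` — is a
concatenation of `K` RICH pieces and a remainder. [this file] -/
theorem exists_rich_pieces {r c : ℕ} :
    ∀ (K : ℕ) (w : List Bool), r * w.count false + c * K < c * w.count true + c →
      ∃ (ps : List (List Bool)) (u : List Bool), ps.length = K ∧ (∀ p ∈ ps, Rich r c p) ∧ w = ps.flatten ++ u := by
  intro K
  induction K with
  | zero =>
    intro w _
    exact ⟨[], w, rfl, fun p hp => by simp at hp, by simp⟩
  | succ K ih =>
    intro w hw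
    have hwr : Rich r c w := by unfold Rich; nlinarith [hw]
    obtain ⟨p, u, rfl, hp, hdeg⟩ := exists_rich_prefix w hwr
    rw [List.count_append, List.count_append] at hw
    have hu : r * u.count false + c * K < c * u.count true + c := by nlinarith [hw, hdeg]
    obtain ⟨ps, u', hlen, hps, rfl⟩ := ih u hu
    refine ⟨p :: ps, u', by rw [List.length_cons, hlen], ?_, by simp⟩
    intro q hq
    rcases List.mem_cons.1 hq with rfl | hq
    · exact hp
    · exact hps q hq

variable (T₀ T₁ : Matrix (Fin m) (Fin m) ℂ) (r c : ℕ)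

/-- The rich words of `(T₀,T₁)` as a set of matrices; `Algebra.adjoin ℂ (richWords …)` is the POSITIVE-DEGREE algebra
`ℂ·1 ⊕ A_{≥1}` of the card. -/
def richWords : Set (Matrix (Fin m) (Fin m) ℂ) := {M | ∃ w : List Bool, Rich r c w ∧ M = word T₀ T₁ w}

/-- The monoid generated by the rich words is `{1} ∪ richWords` (degrees add). [this file] -/
theorem eq_one_or_rich_of_mem_closure {b : Matrix (Fin m) (Fin m) ℂ} (hb : b ∈ Submonoid.closure (richWords T₀ T₁ r c)) :
    b = 1 ∨ ∃ w : List Bool, Rich r c w ∧ b = word T₀ T₁ w := by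
  induction hb using Submonoid.closure_induction with
  | mem x hx => exact Or.inr hx
  | one => exact Or.inl rfl
  | mul x y _ _ ihx ihy =>
    rcases ihx with rfl | ⟨w, hw, rfl⟩
    · rw [one_mul]; exact ihy
    · rcases ihy with rfl | ⟨w', hw', rfl⟩
      · exact Or.inr ⟨w, hw, by rw [mul_one]⟩
      · exact Or.inr ⟨w ++ w', rich_append hw hw', (word_append T₀ T₁ w w').symm⟩

/-- **Necklace-null ⇒ trace-orthogonal.**  If every rich necklace is traceless, every rich word is trace-orthogonal to
the whole positive-degree algebra. [this file] -/
theorem traceOrth_adjoin_of_null (hnull : ∀ w : List Bool, Rich r c w → Matrix.trace (word T₀ T₁ w) = 0)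
    {w : List Bool} (hw : Rich r c w) :
    ∀ b ∈ Algebra.adjoin ℂ (richWords T₀ T₁ r c), Matrix.trace (word T₀ T₁ w * b) = 0 := by
  intro b hb
  have hb' : b ∈ Submodule.span ℂ (Submonoid.closure (richWords T₀ T₁ r c) : Set (Matrix (Fin m) (Fin m) ℂ)) := by
    rw [← Algebra.adjoin_eq_span]; exact hb
  clear hb
  induction hb' using Submodule.span_induction with
  | mem x hx =>
    rcases eq_one_or_rich_of_mem_closure T₀ T₁ r c hx with rfl | ⟨w', hw', rfl⟩
    · rw [mul_one]; exact hnull w hw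
    · rw [← word_append]; exact hnull _ (rich_append hw hw')
  | zero => rw [mul_zero, Matrix.trace_zero]
  | add x y _ _ hx hy => rw [mul_add, Matrix.trace_add, hx, hy, add_zero]
  | smul a x _ hx => rw [mul_smul_comm, Matrix.trace_smul, hx, smul_zero]

/-- **Rich words are radical.**  Under necklace-nullity every rich word lies in the Jacobson radical of the
positive-degree algebra (tree: `RadicalCoarsening.mem_jacobson_of_traceOrth`). [this file] -/
theorem word_mem_jacobson_of_null (hnull : ∀ w : List Bool, Rich r c w → Matrix.trace (word T₀ T₁ w) = 0)
    {w : List Bool} (hw : Rich r c w) :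
    (⟨word T₀ T₁ w, Algebra.subset_adjoin ⟨w, hw, rfl⟩⟩ : Algebra.adjoin ℂ (richWords T₀ T₁ r c)) ∈
      Ideal.jacobson (⊥ : Ideal (Algebra.adjoin ℂ (richWords T₀ T₁ r c))) :=
  mem_jacobson_of_traceOrth _ _ (traceOrth_adjoin_of_null T₀ T₁ r c hnull hw)

/-- **Products of `L` rich words vanish**, `L` the nilpotency exponent of the radical of the positive-degree algebra
(tree: `exists_jacobson_pow_eq_bot`, `list_prod_mem_pow`). [this file] -/
theorem prod_words_eq_zero_of_null (hnull : ∀ w : List Bool, Rich r c w → Matrix.trace (word T₀ T₁ w) = 0)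
    {L : ℕ} (hL : (Ideal.jacobson (⊥ : Ideal (Algebra.adjoin ℂ (richWords T₀ T₁ r c)))) ^ L = ⊥)
    (ps : List (List Bool)) (hps : ∀ p ∈ ps, Rich r c p) (hlen : ps.length = L) :
    (ps.map (word T₀ T₁)).prod = 0 := by
  set 𝒜 := Algebra.adjoin ℂ (richWords T₀ T₁ r c) with h𝒜
  let F : {p // p ∈ ps} → 𝒜 := fun x => ⟨word T₀ T₁ x.1, Algebra.subset_adjoin ⟨x.1, hps x.1 x.2, rfl⟩⟩
  set l : List 𝒜 := ps.attach.map F with hl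
  have hmem := list_prod_mem_pow 𝒜 (Ideal.jacobson (⊥ : Ideal 𝒜)) l (fun x hx => by
    obtain ⟨y, -, rfl⟩ := List.mem_map.1 hx
    exact word_mem_jacobson_of_null T₀ T₁ r c hnull (hps y.1 y.2))
  have hlenl : l.length = L := by rw [hl, List.length_map, List.length_attach, hlen]
  rw [hlenl, hL, Ideal.mem_bot] at hmem
  have hval : ((l.prod : 𝒜) : Matrix (Fin m) (Fin m) ℂ) = (ps.map (word T₀ T₁)).prod := by
    rw [SubmonoidClass.coe_list_prod, hl, List.map_map]
    have hcomp : (Subtype.val ∘ F : {p // p ∈ ps} → Matrix (Fin m) (Fin m) ℂ) = word T₀ T₁ ∘ Subtype.val := by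
      funext x; rfl
    rw [hcomp, ← List.map_map, List.attach_map_subtype_val]
  rw [← hval, hmem]
  rfl

/-- **RATIO COMPLETENESS (King–Procesi, elementary form).**  If every `(r:c)`-rich necklace of `(T₀,T₁)` is
TRACELESS, then `(T₀,T₁)` has a word profile of ratio `(r:c)`: for some height `Θ` (here `Θ = c·(L−1)`, `L` the
nilpotency exponent of the radical of the positive-degree algebra), every NONZERO word satisfies
`c·#T₁(w) ≤ Θ + r·#T₀(w)`.  With §2 this says: necklace traces decide exactly the RATIO clause of a flag certificate
and are blind to its HEIGHT clause. [this file; King 1994 §2, Procesi 1976 — here via Wedderburn–Artin-free Jacobson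
nilpotency, tree `RadicalCoarsening`] -/
theorem exists_profile_of_necklace_null
    (hnull : ∀ w : List Bool, Rich r c w → Matrix.trace (word T₀ T₁ w) = 0) :
    ∃ Θ : ℕ, ∀ w : List Bool, word T₀ T₁ w ≠ 0 → c * w.count true ≤ Θ + r * w.count false := by
  obtain ⟨L, hL⟩ := exists_jacobson_pow_eq_bot (Algebra.adjoin ℂ (richWords T₀ T₁ r c))
  refine ⟨c * (L - 1), fun w hw => ?_⟩
  refine le_of_not_gt fun hlt => ?_
  apply hw
  have hcut : r * w.count false + c * L < c * w.count true + c := by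
    rcases Nat.eq_zero_or_pos L with rfl | hLpos
    · omega
    · obtain ⟨L', rfl⟩ := Nat.exists_eq_add_of_le hLpos
      rw [Nat.add_sub_cancel_left] at hlt
      nlinarith [hlt]
  obtain ⟨ps, u, hlen, hps, rfl⟩ := exists_rich_pieces L w hcut
  rw [word_append, word_flatten, prod_words_eq_zero_of_null T₀ T₁ r c hnull hL ps hps hlen, zero_mul]

/-- **The criterion, both directions, in `WordTame` currency.**  Necklace-nullity at ratio `(r:c)` with `1 ≤ c` gives
`WordTame n k T₀ T₁` for every budget `k ≥ (Θ + r(n−1))/(c+r)` (some `Θ`); conversely (§3) one rich necklace with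
nonzero trace and `T₁`-fraction `≥ (k+1)/(n−1)` forbids `WordTame n k`. [this file] -/
theorem exists_wordTame_of_necklace_null (hc : 1 ≤ c)
    (hnull : ∀ w : List Bool, Rich r c w → Matrix.trace (word T₀ T₁ w) = 0) :
    ∃ Θ : ℕ, ∀ n k : ℕ, (Θ + r * (n - 1)) / (c + r) ≤ k → WordTame n k T₀ T₁ := by
  obtain ⟨Θ, hΘ⟩ := exists_profile_of_necklace_null T₀ T₁ r c hnull
  exact ⟨Θ, fun n k hk => ⟨r, c, Θ, hc, hk, hΘ⟩⟩

end Completeness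

end Summit.ValiantsHypothesis.ValiantsHypothesis.Theorems.GrenetZeon.Necklace
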